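/-
Copyright (c) 2026 the pub-hodgecm-mathlib formalisation cell (harness21).  Prover seat hodgecm-mathlib-K2E1-p03 (g2), Track B ∕ K2-LIT (stream 29),
h413 = `stmt-HodgeConjecture-24833`, line `K2_E1_TraceFormulaBeta`, helper `K2E1FixedTensorExhaust` (dealer K2E1-plan (g0) RE-DEAL 2026-09-03T22:52:54Z,
blueprint K2E1-p08 (g0) 22:51:26Z): `(⨂_i V_i)^{∏ K_i} = ⨂_i V_i^{K_i}` for EVERY family of representations over `ℂ` — linear algebra, no smoothness.  2026-09-03.
-/
import Summits.HodgeConjecture.HodgeConjecture.Theorems.K2E1FixedVectorsTensorFactor   -- ★ p855413∕p855429 (K2E1-p08): `piTensorRep`, `fixedTensorMap`, `FixedTensorExhaust`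
import Mathlib.LinearAlgebra.PiTensorProduct.Basis                                   -- `Basis.piTensorProduct`, `piTensorProduct_apply`
import Mathlib.LinearAlgebra.Projection                                              -- `Submodule.exists_isCompl`, `prodEquivOfIsCompl`
import Mathlib.LinearAlgebra.Basis.Prod                                              -- `Basis.prod`
import Mathlib.LinearAlgebra.Dual.Lemmas                                             -- `Module.forall_dual_apply_eq_zero_iff`
import Mathlib.Algebra.BigOperators.Group.Finset.Preimage                            -- `Finset.sum_preimage`
import HarnessLib

/-!
# h413 ∕ Track B «K2-LIT», line `K2_E1_TraceFormulaBeta`, row 18: THE FIXED VECTORS OF A TENSOR PRODUCT — `(⨂_i V_i)^{∏_i K_i} = ⨂_i V_i^{K_i}` FOR EVERY FAMILY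
# (helper `K2E1FixedTensorExhaust`: the residual Prop `FixedTensorExhaust ρ K` of ★ `K2E1FixedVectorsTensorFactor` PROVED; RE-DEAL of K2E1-plan (g0) 2026-09-03T22:52:54Z
# on K2E1-p08 (g0)'s BLUEPRINT `K2/STATUS.md` 22:51:26Z)

Cell `pub/hodgecm-mathlib`, crux H413 = `stmt-HodgeConjecture-24833`, route `HCCMUnconditional`; chair K2-lead (g0), dealer K2E1-plan (g0).  THEOREMS ONLY (pure Mathlib linear
algebra over ★ p855413's two definitions; no `def`, no `instance`, no `notation`, no named-fact hypothesis, no `sorry`); lane `--supports stmt-HodgeConjecture-24833 --as helper`.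

THE STATEMENT.  ★ `K2E1FixedVectorsTensorFactor` (K2E1-p08 (g0), p855413; erratum ED. 2 p855429) defines, for a family of representations `ρ_i : G_i → GL(V_i)` over `ℂ` and
subgroups `K_i ≤ G_i` (any index type `ι`), the external tensor product `piTensorRep ρ` of `∏_i G_i` on `⨂[ℂ] i, V_i`, the natural map `fixedTensorMap ρ K : ⨂_i V_i^{K_i} → ⨂_i V_i`
(injective, landing in the `∏_i K_i`-fixed vectors), and the residual Prop
  `FixedTensorExhaust ρ K := (⨂_i V_i)^{∏_i K_i} ≤ range (fixedTensorMap ρ K)`,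
under which ★ `fixedTensorEquiv` is the isomorphism `⨂_i V_i^{K_i} ≃ (⨂_i V_i)^{∏ K_i}` consumed by row 18 (★ `K2E1FlathSmoothLayer`).  THIS FILE PROVES IT for EVERY family
(finite `ι`), by linear algebra — **`fixedTensorExhaust_holds : FixedTensorExhaust ρ K`** — so K2E1-p08's conditional heads `…_of_exhaust` discharge BY NAME.

THE MATHEMATICS (p08's blueprint, with the slot-`j` coefficient comparison done through linear functionals).  (a) ADAPTED BASES (`exists_adapted_basis`): `V_i = W_i ⊕ C_i`
with `W_i := V_i^{K_i}` (`Submodule.exists_isCompl`), and a basis `b_i` of `V_i` indexed by `A_i ⊕ B_i` whose `inl`-vectors lie in `W_i` and such that vectors of `W_i` have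
vanishing `inr`-coordinates (`Basis.prod` through `prodEquivOfIsCompl`).  (b) TENSOR BASIS `B := Basis.piTensorProduct b` (Mathlib), `B p = ⊗_i b_i(p_i)`.  (c) SLOT
FUNCTIONALS (`slotFunctional_*`): for a multi-index `p`, a slot `j` and `ℓ ∈ V_j^*`, the functional `Λ_{p,ℓ} := lift (∏_i f_i)`, `f_i = b_i^*(p_i)` (`i ≠ j`), `f_j = ℓ`
(`MultilinearMap.mkPiAlgebra` composed with the `f_i`) satisfies `Λ_{p,ℓ} ∘ (⊗ρ)(k at slot j) = Λ_{p, ℓ ∘ ρ_j(k)}` (check on pure tensors) and `Λ_{p,ℓ}(x) = ℓ(w_p(x))` for the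
SLOT VECTOR `w_p(x) := Σ_q B^*(x)_{p[j↦q]} · b_j(q) ∈ V_j` (a finite sum over the support; `Finset.sum_preimage` along `q ↦ p[j↦q]`), whose coordinates are
`b_j^*(w_p(x))_q = B^*(x)_{p[j↦q]}`.  (d) If `x` is `∏K_i`-fixed then `ℓ(ρ_j(k) w_p(x)) = ℓ(w_p(x))` for all `ℓ`, so `w_p(x) ∈ W_j` (linear functionals separate points, Mathlib
`Module.forall_dual_apply_eq_zero_iff`), hence `B^*(x)_p = 0` whenever some `p_j ∈ B_j` (`repr_eq_zero_of_inr`).  (e) So `x = Σ_p B^*(x)_p · ⊗_i b_i(p_i)` runs over `inl`-indices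
only, each `⊗_i b_i(p_i) = fixedTensorMap (⊗_i b_i(p_i))` with `b_i(p_i) ∈ W_i`, and `x ∈ range fixedTensorMap`.

HONEST LABEL.  HC_CM is proved only modulo the 7 printed citations (2 remaining named inputs: hLiu418 = `stmt-HodgeConjecture-24832`, h413 = `stmt-HodgeConjecture-24833`)
until rung 0 closes; this file proves no printed statement of [Rogawski1990] and is count-neutral.

## References
* [Bump1997] D. Bump, *Automorphic Forms and Representations* (1997), §3.4 (restricted tensor products, `(⊗π_v)^{K} = ⊗ π_v^{K_v}`).
* [FlathCorvallis1979] D. Flath, *Decomposition of representations into tensor products*, Proc. Sympos. Pure Math. 33.1 (1979), §2 (Thm. 2, Example 2).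
-/

set_option autoImplicit false
set_option linter.dupNamespace false  -- the mandated namespace repeats the summit's segment (`HodgeConjecture.HodgeConjecture`)

noncomputable section

namespace Summit.HodgeConjecture.HodgeConjecture.Cruxes.H413.K2E1FixedTensorExhaust

open scoped TensorProduct
open Module PiTensorProduct Summit.HodgeConjecture.HodgeConjecture.Cruxes.H413.K2E1FixedVectorsTensorFactor

/-! ## §1 Adapted bases: `V = W ⊕ C`, `inl`-vectors in `W`, `W`-vectors with vanishing `inr`-coordinates -/

section Adapted

variable {M : Type} [AddCommGroup M] [Module ℂ M]

/-- **Adapted basis of a subspace**: for `W ≤ M` (a `ℂ`-vector space) there is a basis `b` of `M` indexed by a sum type `A ⊕ B` with `b (inl a) ∈ W` for all `a` and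
`b^*(m)_{inr c} = 0` for all `m ∈ W` (a basis of `W` followed by a basis of a complement `C`, `M = W ⊕ C`, Mathlib `Submodule.exists_isCompl` ∕ `Basis.prod` ∕
`prodEquivOfIsCompl`). [folklore] -/
theorem exists_adapted_basis (W : Submodule ℂ M) :
    ∃ (A B : Type) (b : Basis (A ⊕ B) ℂ M), (∀ a, b (Sum.inl a) ∈ W) ∧ ∀ m ∈ W, ∀ c, b.repr m (Sum.inr c) = 0 := by
  obtain ⟨C, hC⟩ := W.exists_isCompl
  let bW := Basis.ofVectorSpace ℂ W
  let bC := Basis.ofVectorSpace ℂ C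
  let e := Submodule.prodEquivOfIsCompl W C hC
  refine ⟨_, _, (bW.prod bC).map e, fun a => ?_, fun m hm c => ?_⟩
  · rw [Basis.map_apply, Basis.prod_apply, Sum.elim_inl, Function.comp_apply, LinearMap.inl_apply, Submodule.coe_prodEquivOfIsCompl']
    simp
  · change (bW.prod bC).repr (e.symm m) (Sum.inr c) = 0
    have h : e.symm m = ((⟨m, hm⟩ : W), (0 : C)) := Submodule.prodEquivOfIsCompl_symm_apply_left (p := W) (q := C) hC (⟨m, hm⟩ : W)
    rw [h, Basis.prod_repr_inr, map_zero, Finsupp.zero_apply]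

end Adapted

/-! ## §2 Slot functionals `Λ_{p,ℓ} = lift (∏_i f_i)` on `⨂_i V_i` and the slot vectors `w_p(x) ∈ V_j` -/

section Slot

variable {ι : Type} [Fintype ι] [DecidableEq ι] {G : ι → Type} [∀ i, Group (G i)] {V : ι → Type} [∀ i, AddCommGroup (V i)] [∀ i, Module ℂ (V i)]
  (ρ : ∀ i, Representation ℂ (G i) (V i))

omit [DecidableEq ι] in
/-- `lift (∏_i f_i) (⊗_i v_i) = ∏_i f_i(v_i)` for linear functionals `f_i`. [folklore] -/
theorem lift_prod_tprod (f : ∀ i, V i →ₗ[ℂ] ℂ) (v : ∀ i, V i) :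
    PiTensorProduct.lift ((MultilinearMap.mkPiAlgebra ℂ ι ℂ).compLinearMap f) (tprod ℂ v) = ∏ i, f i (v i) := by
  rw [PiTensorProduct.lift.tprod, MultilinearMap.compLinearMap_apply, MultilinearMap.mkPiAlgebra_apply]

omit [DecidableEq ι] in
/-- **Intertwining**: `lift (∏ f_i) ((⊗ρ_i)(g) y) = lift (∏ (f_i ∘ ρ_i(g_i))) y` (check on pure tensors). [cite: Bump1997, §3.4] -/
theorem lift_prod_piTensorRep (f : ∀ i, V i →ₗ[ℂ] ℂ) (g : ∀ i, G i) (y : ⨂[ℂ] i, V i) :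
    PiTensorProduct.lift ((MultilinearMap.mkPiAlgebra ℂ ι ℂ).compLinearMap f) (piTensorRep ρ g y) =
      PiTensorProduct.lift ((MultilinearMap.mkPiAlgebra ℂ ι ℂ).compLinearMap fun i => f i ∘ₗ ρ i (g i)) y := by
  suffices h : PiTensorProduct.lift ((MultilinearMap.mkPiAlgebra ℂ ι ℂ).compLinearMap f) ∘ₗ piTensorRep ρ g =
      PiTensorProduct.lift ((MultilinearMap.mkPiAlgebra ℂ ι ℂ).compLinearMap fun i => f i ∘ₗ ρ i (g i)) from
    LinearMap.congr_fun h y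
  refine PiTensorProduct.ext ?_
  ext v
  simp only [LinearMap.compMultilinearMap_apply, LinearMap.coe_comp, Function.comp_apply, piTensorRep_tprod, lift_prod_tprod]

variable {κ : ι → Type} (b : ∀ i, Basis (κ i) ℂ (V i)) (j : ι) (p : ∀ i, κ i)

omit [Fintype ι] in
/-- The slot-`j` family of functionals `f_i = b_i^*(p_i)` (`i ≠ j`), `f_j = ℓ`, precomposed with `ρ` at the element `k` placed in slot `j`, is the family for `ℓ ∘ ρ_j(k)`
(`ρ_i(1) = 1` off `j`). [folklore] -/
theorem update_comp_mulSingle (ℓ : V j →ₗ[ℂ] ℂ) (k : G j) :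
    (fun i => Function.update (fun i => (b i).coord (p i)) j ℓ i ∘ₗ ρ i (Pi.mulSingle j k i)) =
      Function.update (fun i => (b i).coord (p i)) j (ℓ ∘ₗ ρ j k) := by
  funext i
  by_cases h : i = j
  · subst h
    rw [Function.update_self, Function.update_self, Pi.mulSingle_eq_same]
  · rw [Function.update_of_ne h, Function.update_of_ne h, Pi.mulSingle_eq_of_ne h, map_one]
    exact LinearMap.ext fun v => rfl

open scoped Classical in
/-- **Value of a slot functional on a basis tensor**: `Λ_{p,ℓ}(⊗_i b_i(p'_i)) = ℓ(b_j(p'_j)) · [p'_i = p_i for all i ≠ j]`. [folklore] -/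
theorem lift_prod_basis (ℓ : V j →ₗ[ℂ] ℂ) (p' : ∀ i, κ i) :
    PiTensorProduct.lift ((MultilinearMap.mkPiAlgebra ℂ ι ℂ).compLinearMap (Function.update (fun i => (b i).coord (p i)) j ℓ))
        (Basis.piTensorProduct b p') =
      ℓ (b j (p' j)) * (if ∀ i ∈ Finset.univ.erase j, p' i = p i then 1 else 0) := by
  rw [Basis.piTensorProduct_apply, lift_prod_tprod, ← Finset.mul_prod_erase Finset.univ _ (Finset.mem_univ j), Function.update_self]
  congr 1
  have hfac : ∀ i ∈ Finset.univ.erase j, Function.update (fun i => (b i).coord (p i)) j ℓ i (b i (p' i)) = if p' i = p i then 1 else 0 := fun i hi => by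
    rw [Function.update_of_ne (Finset.ne_of_mem_erase hi), Basis.coord_apply, Basis.repr_self, Finsupp.single_apply]
  rw [Finset.prod_congr rfl hfac]
  split_ifs with h
  · exact Finset.prod_eq_one fun i hi => if_pos (h i hi)
  · push Not at h
    obtain ⟨i, hi, hne⟩ := h
    exact Finset.prod_eq_zero hi (if_neg hne)

/-- **The slot functional as a finite sum over the slot-`j` fibre of the support**: `Λ_{p,ℓ}(x) = Σ_{q : p[j↦q] ∈ supp B^*(x)} B^*(x)_{p[j↦q]} · ℓ(b_j(q))`
(expand `x` in the tensor basis; only indices agreeing with `p` off `j` contribute; reindex by `q ↦ p[j↦q]`, `Finset.sum_preimage`). [folklore] -/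
theorem lift_prod_eq_sum (ℓ : V j →ₗ[ℂ] ℂ) (x : ⨂[ℂ] i, V i) :
    PiTensorProduct.lift ((MultilinearMap.mkPiAlgebra ℂ ι ℂ).compLinearMap (Function.update (fun i => (b i).coord (p i)) j ℓ)) x =
      ∑ q ∈ ((Basis.piTensorProduct b).repr x).support.preimage (Function.update p j) (Function.update_injective p j).injOn,
        (Basis.piTensorProduct b).repr x (Function.update p j q) * ℓ (b j q) := by
  classical
  set B := Basis.piTensorProduct b with hB
  set Λ := PiTensorProduct.lift ((MultilinearMap.mkPiAlgebra ℂ ι ℂ).compLinearMap (Function.update (fun i => (b i).coord (p i)) j ℓ)) with hΛ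
  -- expand `x` in the basis `B`
  have hx : Λ x = ∑ p' ∈ (B.repr x).support, B.repr x p' * (ℓ (b j (p' j)) * (if ∀ i ∈ Finset.univ.erase j, p' i = p i then 1 else 0)) := by
    conv_lhs => rw [← B.linearCombination_repr x, Finsupp.linearCombination_apply, Finsupp.sum, map_sum]
    refine Finset.sum_congr rfl fun p' _ => ?_
    rw [map_smul, smul_eq_mul, hB, lift_prod_basis b j p ℓ p']
  rw [hx]
  symm
  refine (Finset.sum_preimage (Function.update p j) (B.repr x).support (Function.update_injective p j).injOn
    (fun p' => B.repr x p' * (ℓ (b j (p' j)) * (if ∀ i ∈ Finset.univ.erase j, p' i = p i then 1 else 0))) fun p' _ hp' => ?_).symm.trans ?_ |>.symm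
  · -- indices off the range of `q ↦ p[j↦q]` contribute `0`
    have h : ¬ ∀ i ∈ Finset.univ.erase j, p' i = p i := by
      intro hall
      apply hp'
      refine ⟨p' j, funext fun i => ?_⟩
      by_cases hi : i = j
      · subst hi; rw [Function.update_self]
      · rw [Function.update_of_ne hi]; exact (hall i (Finset.mem_erase.mpr ⟨hi, Finset.mem_univ i⟩)).symm
    rw [if_neg h, mul_zero, mul_zero]
  · refine Finset.sum_congr rfl fun q _ => ?_
    have h : ∀ i ∈ Finset.univ.erase j, Function.update p j q i = p i := fun i hi => Function.update_of_ne (Finset.ne_of_mem_erase hi) _ _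
    rw [if_pos h, mul_one, Function.update_self]

/-- **The slot vector `w_p(x) := Σ_q B^*(x)_{p[j↦q]} · b_j(q) ∈ V_j` represents the slot functionals**: `ℓ(w_p(x)) = Λ_{p,ℓ}(x)` for every `ℓ`. [folklore] -/
theorem apply_slotVector (ℓ : V j →ₗ[ℂ] ℂ) (x : ⨂[ℂ] i, V i) :
    ℓ (∑ q ∈ ((Basis.piTensorProduct b).repr x).support.preimage (Function.update p j) (Function.update_injective p j).injOn,
        (Basis.piTensorProduct b).repr x (Function.update p j q) • b j q) =
      PiTensorProduct.lift ((MultilinearMap.mkPiAlgebra ℂ ι ℂ).compLinearMap (Function.update (fun i => (b i).coord (p i)) j ℓ)) x := by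
  rw [lift_prod_eq_sum, map_sum]
  exact Finset.sum_congr rfl fun q _ => by rw [map_smul, smul_eq_mul]

/-- **Coordinates of the slot vector**: `b_j^*(w_p(x))_q = B^*(x)_{p[j↦q]}` for every `q`. [folklore] -/
theorem repr_slotVector (x : ⨂[ℂ] i, V i) (q : κ j) :
    (b j).repr (∑ q' ∈ ((Basis.piTensorProduct b).repr x).support.preimage (Function.update p j) (Function.update_injective p j).injOn,
        (Basis.piTensorProduct b).repr x (Function.update p j q') • b j q') q =
      (Basis.piTensorProduct b).repr x (Function.update p j q) := by
  classical
  set B := Basis.piTensorProduct b with hB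
  rw [map_sum, Finsupp.coe_finsetSum, Finset.sum_apply]
  simp only [map_smul, Basis.repr_self, Finsupp.smul_single, smul_eq_mul, mul_one, Finsupp.single_apply]
  rw [Finset.sum_ite_eq']
  split_ifs with h
  · rfl
  · rw [Finset.mem_preimage] at h
    exact (Finsupp.notMem_support_iff.mp h).symm

/-- **Fixed tensors have `W_j`-valued slot vectors**: if `(⊗ρ)(k at slot j) x = x` for all `k ∈ K_j`, then `ρ_j(k) w_p(x) = w_p(x)` for all `k ∈ K_j` (all linear functionals
agree on the two sides — `ℓ ∘ ρ_j(k)` is again a functional — and functionals separate points, Mathlib `Module.forall_dual_apply_eq_zero_iff`). [cite: Bump1997, §3.4] -/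
theorem slotVector_mem_fixedPoints (K : Subgroup (G j)) (x : ⨂[ℂ] i, V i) (hx : ∀ k ∈ K, piTensorRep ρ (Pi.mulSingle j k) x = x) :
    (∑ q ∈ ((Basis.piTensorProduct b).repr x).support.preimage (Function.update p j) (Function.update_injective p j).injOn,
        (Basis.piTensorProduct b).repr x (Function.update p j q) • b j q) ∈ (ρ j).fixedPoints K := by
  rw [Representation.mem_fixedPoints]
  intro k hk
  rw [← sub_eq_zero, ← Module.forall_dual_apply_eq_zero_iff ℂ]
  intro ℓ
  rw [map_sub, sub_eq_zero, ← LinearMap.comp_apply, apply_slotVector, apply_slotVector, ← update_comp_mulSingle ρ b j p ℓ k,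
    ← lift_prod_piTensorRep ρ _ (Pi.mulSingle j k) x, hx k hk]

end Slot

/-! ## §3 The exhaustion `(⨂_i V_i)^{∏ K_i} ≤ range fixedTensorMap` -/

section Exhaust

variable {ι : Type} {G : ι → Type} [∀ i, Group (G i)] {V : ι → Type} [∀ i, AddCommGroup (V i)] [∀ i, Module ℂ (V i)]
  (ρ : ∀ i, Representation ℂ (G i) (V i)) (K : ∀ i, Subgroup (G i))

/-- A `∏_i K_i`-fixed tensor is fixed by each `k ∈ K_j` placed in slot `j`. [folklore] -/
theorem piTensorRep_mulSingle_eq [DecidableEq ι] {x : ⨂[ℂ] i, V i} (hx : x ∈ (piTensorRep ρ).fixedPoints (Subgroup.pi Set.univ K)) (j : ι) (k : G j) (hk : k ∈ K j) :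
    piTensorRep ρ (Pi.mulSingle j k) x = x := by
  rw [Representation.mem_fixedPoints] at hx
  refine hx _ ((Subgroup.mem_pi _).mpr fun i _ => ?_)
  by_cases h : i = j
  · subst h; rwa [Pi.mulSingle_eq_same]
  · rw [Pi.mulSingle_eq_of_ne h]; exact one_mem _

/-- **Vanishing of the `inr`-coefficients**: for adapted bases `b_i` (vectors of `V_i^{K_i}` have vanishing `inr`-coordinates) and a `∏K_i`-fixed `x`, the tensor-basis coordinate
`B^*(x)_p` vanishes as soon as one index `p_j` is an `inr` (it is the `inr`-coordinate of the `K_j`-fixed slot vector `w_p(x)`). [cite: Bump1997, §3.4] [cite: FlathCorvallis1979, §2] -/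
theorem repr_eq_zero_of_inr [Fintype ι] [DecidableEq ι] {A B : ι → Type} (b : ∀ i, Basis (A i ⊕ B i) ℂ (V i))
    (hbr : ∀ i, ∀ m ∈ (ρ i).fixedPoints (K i), ∀ c, (b i).repr m (Sum.inr c) = 0)
    {x : ⨂[ℂ] i, V i} (hx : x ∈ (piTensorRep ρ).fixedPoints (Subgroup.pi Set.univ K)) (p : ∀ i, A i ⊕ B i) (j : ι) (c : B j) (hp : p j = Sum.inr c) :
    (Basis.piTensorProduct b).repr x p = 0 := by
  have hw := slotVector_mem_fixedPoints ρ b j p (K j) x (fun k hk => piTensorRep_mulSingle_eq ρ K hx j k hk)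
  have h := hbr j _ hw c
  rw [repr_slotVector] at h
  rwa [← hp, Function.update_eq_self] at h

/-- **THE EXHAUSTION `FixedTensorExhaust ρ K` HOLDS for every family over `ℂ`** (finite `ι`): every `∏_i K_i`-fixed tensor lies in the image of `⨂_i V_i^{K_i}` — in the adapted
tensor basis its coordinates live on `inl`-indices only, and each such basis tensor is `fixedTensorMap` of a pure tensor of fixed vectors.  This is the residual Prop of
★ `K2E1FixedVectorsTensorFactor` (its ED. 2 erratum: no smoothness is needed), so ★ `fixedTensorEquiv ρ K fixedTensorExhaust_holds : ⨂_i V_i^{K_i} ≃ (⨂_i V_i)^{∏K_i}`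
is UNCONDITIONAL. [cite: Bump1997, §3.4] [cite: FlathCorvallis1979, §2] -/
theorem fixedTensorExhaust_holds [Finite ι] : FixedTensorExhaust ρ K := by
  classical
  haveI := Fintype.ofFinite ι
  intro x hx
  -- adapted bases in every slot
  have hab := fun i => exists_adapted_basis ((ρ i).fixedPoints (K i))
  choose A B b hbW hbr using hab
  set Bt := Basis.piTensorProduct b with hBt
  -- every index in the support of `B^*(x)` is `inl`-valued in every slot, so its basis tensor is in the range
  have hmem : ∀ p ∈ (Bt.repr x).support, Bt p ∈ LinearMap.range (fixedTensorMap ρ K) := by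
    intro p hp
    have hW : ∀ i, b i (p i) ∈ (ρ i).fixedPoints (K i) := by
      intro i
      rcases hpi : p i with a | c
      · exact hbW i a
      · exact absurd (repr_eq_zero_of_inr ρ K b hbr hx p i c hpi) (Finsupp.mem_support_iff.mp hp)
    refine ⟨tprod ℂ fun i => (⟨b i (p i), hW i⟩ : (ρ i).fixedPoints (K i)), ?_⟩
    rw [fixedTensorMap_tprod, hBt, Basis.piTensorProduct_apply]
  rw [← Bt.linearCombination_repr x, Finsupp.linearCombination_apply, Finsupp.sum]
  exact Submodule.sum_mem _ fun p hp => Submodule.smul_mem _ _ (hmem p hp)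

/-- **`⨂_i V_i^{K_i} ≃ₗ (⨂_i V_i)^{∏_i K_i}`, unconditionally** (★ `fixedTensorEquiv` at `fixedTensorExhaust_holds`); on vectors it is `fixedTensorMap`
(★ `coe_fixedTensorEquiv_apply`). [cite: FlathCorvallis1979, §2] [cite: Bump1997, §3.4] -/
theorem coe_fixedTensorEquiv_holds_apply [Finite ι] (x : ⨂[ℂ] i, (ρ i).fixedPoints (K i)) :
    ((fixedTensorEquiv ρ K (fixedTensorExhaust_holds ρ K) x : (piTensorRep ρ).fixedPoints (Subgroup.pi Set.univ K)) : ⨂[ℂ] i, V i) =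
      fixedTensorMap ρ K x :=
  rfl

/-- **`range fixedTensorMap = (⨂_i V_i)^{∏ K_i}`** (★ `range_fixedTensorMap_le` and the exhaustion). [cite: FlathCorvallis1979, §2] -/
theorem range_fixedTensorMap_eq [Finite ι] :
    LinearMap.range (fixedTensorMap ρ K) = (piTensorRep ρ).fixedPoints (Subgroup.pi Set.univ K) :=
  le_antisymm (range_fixedTensorMap_le ρ K) (fixedTensorExhaust_holds ρ K)

end Exhaust

end Summit.HodgeConjecture.HodgeConjecture.Cruxes.H413.K2E1FixedTensorExhaust

end
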